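import Summits.QuantumFields.YangMills.Theorems.LuscherReductionDressedRitzPolyakovLiftPScalingOfQuasimodes
import Summits.QuantumFields.YangMills.Theorems.LuscherReductionDressedRitzPolyakovLiftPScalingQuasimodes
import Summits.QuantumFields.YangMills.Theorems.LuscherReductionRunningReductionKTRCalibration
import HarnessLib

/-!
# Route `LuscherReduction`, item `DressedRitz` (stmt-QuantumFields-20205), line «polyakovlift» r7 — ★★★ STUB S-PSCAL″ CLOSED:
# `∀ k, PScalingExistsForL (TransplantBasisLR k)` (the registered text of `stub_pscaling`, sorry-free)

LEAD prover ym-lead-20205-polyakovlift g3 (`--supports stmt-QuantumFields-20205`).  This file composes the three landed layers of the S-PSCAL″ assembly of the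
line into the REGISTERED stub text `Stmt.stub_pscaling := ∀ k : ℕ, PScalingExistsForL (TransplantBasisLR k)` of skeleton r7 (b06d67d4467729f8):

* (Q) the quasimode package `PScal.quasimode_package` (`…PScalingQuasimodes.lean`, seat ym-infvol-p2 g8 over the LEAD g2 draft: explicit gnomonic-chart
  quasimodes `Ψ_j = (χ_{ρ_j}F_j)∘gnCoord(Λ/(2L))` of an AL1 eigenfamily `F` of Lüscher's matrix Hamiltonian, first moments, near-orthogonality, window/gap data,
  the sup bound of the transplanted observables from the ground-state lower bound `f_0 ≥ c e^{−‖y‖⁴/18}`, contamination smallness);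
* (D5b) the threshold shell `PScal.pscalingExistsForL_transplantLR_of_quasimodes` (`…PScalingOfQuasimodes.lean`, seat ym-20205-polyakovlift-s1 g3: cluster end
  `K ≥ k`, positive-ground-state eigenfamily, dressed level data (D)+(C) `PScal.dressed_level_data`, all side conditions discharged deep in the window, final call
  of the LEAD's core `PScal.pscaling_core`, `…PScalingAssembly.lean`);
* antitonicity of the one-site levels `KTRCalibration.levelValue_antitone` (at `L = 1`; that module sits in the route's theses cone — the gate's dedup lint
  forbids a route-independent copy, so the cone import is accepted here; the skeleton that consumes this file is in the cone by construction).

★★★ `pscalingExistsForL_transplantLR (k) : PScalingExistsForL (TransplantBasisLR k)` and the registered stub verbatim, `stub_pscaling :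
∀ k : ℕ, PScalingExistsForL (TransplantBasisLR k)` (name + signature as registered on the crux item by skeleton r7′).  With it the skeleton's sorry at
`stub_pscaling` is replaced BY NAME (r8 = r7 with three stubs: statics ∕ universality ∕ leakage — renormalisation-group estimates, open by design).

WHAT THIS SAYS: for every level count `k`, deep in the femto window (`λ ≤ lam0(k)`, `L ≥ L0(lam)`, `Λ ∈ [lam, 2lam]`), the ONE-SITE SHADOW at coupling
`B = 2L³/Λ³` of the explicit transplanted observables `g_i = (χ_R f_{i+1}/f_0)∘rootCoord L (Λ/2)` (`R = Λ^{−1/4}`), inserted against ANY raw one-site vacuum and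
dressed by `L` transfer steps, satisfies (o0′) non-vanishing, (o5′) two-sided Lüscher position `⟨w_i,K_B w_i⟩/‖w_i‖² = e^{±CΛ²/L} μ_{i+1}` and (o6′) symmetrised
couplings `≤ C(Λ²/L)μ₀‖w_i‖‖w_l‖` — the one-site half of the Lüscher position of the line, now a theorem.

HONEST FRAMING: closes ONE registered stub (the one-site semiclassical one) of ONE line on the CONDITIONAL femto rung R2b1 (`FemtoGapOfRecord`); the three
remaining stubs (S-STAT″, S-UNIV′, S-LEAK) are renormalisation-group estimates on the fine lattice, not in print; nothing here bears on infinite volume, the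
continuum limit or the Clay mass gap.  References: M. Lüscher, NPB 219 (1983) 233 [cite: Luscher1983, §2–§3]; Reed–Simon IV [cite: ReedSimonIV1978, Thm. XIII.1];
R. Carmona, B. Simon, CMP 80 (1981) 59 [cite: CarmonaSimon1981].
-/

set_option autoImplicit false

noncomputable section

open MeasureTheory Filter Topology Real
open Literature.MathematicalPhysics.QuantumFieldTheory (GaugeConfig Site gaugeTransform)
open scoped BigOperators

namespace Summit.QuantumFields.YangMills.Theorems.FemtoTransferGap.PolyakovLift

open Summit.QuantumFields.YangMills.Theorems.FemtoTransferGap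

/-! ## ★★★ S-PSCAL″ closed -/

/-- ★★★ **S-PSCAL″ (the one-site Lüscher position of the explicit transplant shadows), for every level count `k`:**
`PScalingExistsForL (TransplantBasisLR k)` — the quasimode package (Q) fed to the threshold shell (D5b) over the assembly core, with the one-site levels antitone.
[cite: Luscher1983, §2–§3] [cite: ReedSimonIV1978, Thm. XIII.1] [cite: CarmonaSimon1981] -/
theorem pscalingExistsForL_transplantLR (k : ℕ) : PScalingExistsForL (TransplantBasisLR k) :=
  PScal.pscalingExistsForL_transplantLR_of_quasimodes
    (fun _K _k hkK hK _F hF hFpos => PScal.quasimode_package hkK hK hF hFpos)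
    (fun _B hB => KTRCalibration.levelValue_antitone (L := 1) hB) k

/-- ★★★ **The registered stub `stub_pscaling` of skeleton r7′ (line «polyakovlift», crux stmt-QuantumFields-20205), BY NAME AND SIGNATURE, sorry-free:**
`∀ k : ℕ, PScalingExistsForL (TransplantBasisLR k)`. [cite: Luscher1983, §2–§3] -/
theorem stub_pscaling : ∀ k : ℕ, PScalingExistsForL (TransplantBasisLR k) :=
  pscalingExistsForL_transplantLR

end Summit.QuantumFields.YangMills.Theorems.FemtoTransferGap.PolyakovLift

end
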